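/-
Copyright: cell pub-balaban-gaps (YM BLITZ Y1, track G1), seat g1-p2 GEN 12 (unit `pub-balaban-gaps-g1-p2`).  Row (D4) NODE O,
MECHANISM level — ROAD (c′) of g1-plan-1 GEN 39 ([G1-PLAN1-G39-PRECISION-110], skeleton #26 (R)(C)): the RESUMMATION (3.87)–(3.88) of
the one-scale covariant operator from WHOLE-torus local operators read in PER-CUBE GAUGES, by COLUMN AGREEMENT behind a partition of
unity `Σ_□ h_□² = 1` — no compression, no Dirichlet sub-domain propagator —, and the COLUMN FIELD-LOCALITY of `Δ_W + m² + a_KP_K(U)`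
that supplies the agreement.  HONEST FRAMING: [folklore] matrix algebra over 59b ∕ 63 ∕ 64 ∕ 118's definitions; the local fields, the
gauges and the partition of unity are data; nothing of Bałaban's `Δ^{(k)}(𝐔)` is constructed; words of row (D4) UNCHANGED
(`ExistsUniformAcrossSmall` + `TermDomination`, OBJECT level); (D4) instance 0∕1; NOT BetaPertH, NOT continuum, NOT Clay.
-/
import Summits.QuantumFields.BalabanUV.Gaps.D4WalkBlockFormGaugeTorus
import Summits.QuantumFields.BalabanUV.Gaps.D4WalkBlockCovariantDerivative
import Summits.QuantumFields.BalabanUV.Gaps.D4WalkBlockShiftWeightedAv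

/-!
# `Gaps.D4WalkBlockSeedResummation` — (3.87)–(3.88): `Δ′·Σ_□ h_□G_□h_□ = 1 − R` from whole-torus local inverses in per-cube gauges,
# by column agreement; column field-locality of `Δ_W + m² + a_KP_K(U)` (cell pub-balaban-gaps, seat g1-p2 gen 12)

HONEST DEPENDENCY (cell pub-balaban, verbatim): continuum YM on T⁴ ⇐ BetaPertH ∧ nine spine estimates (0/9 proved);
BetaPertH ⇐ (D1) ∧ (D4) ∧ CAP+tail.

[B9] (3.87) p. 409: `G = Σ_□ h_□G_□h_□`, (3.88): `Δ′G = 1 − R` with `R` built of commutators of `Δ′` with `h_□`; p. 410: «a term … depends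
on U restricted to □̃₀ ∪ … ∪ □̃_j».  Print takes `G_□` = the Dirichlet propagator of the sub-domain `□̃`; ROAD (c′) (g1-plan-1 GEN 39)
takes instead a WHOLE-torus inverse `G′(Ũ^□)` of the operator of a field `Ũ^□` that AGREES with `U^{g_□}` (the cube's (3.35) gauge) on
the bonds read by the columns of `Δ′` over `supp h_□`.  This file is the algebra of that junction:
* §1 **`resummation_of_colAgree`** — `Σ_b H_b² = 1`, `A·H_b = A_b·H_b`, `A_bG_b = 1` ⟹ `A·Σ_b H_bG_bH_b = 1 − Σ_b (H_bA_b − A_bH_b)G_bH_b`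
  (arbitrary square matrices); `rightInverse_of_resummation` ∕ `inv_eq_of_resummation` (`A⁻¹ = S(1 − R)⁻¹`).
* §2 the weight-operator algebra the junction uses: `wOp_add` ∕ `_sub` ∕ `_neg` ∕ `_smul` ∕ `_sum` ∕ `_const_one`, `sum_wOp_sq`
  (`Σ_b (h_b ⊗ 1)² = 1`), `wOp_commutator_apply` (`[h ⊗ 1, M]_{pq} = (h(p) − h(q))M_{pq}`), **`mul_wOp_eq_of_columns`**.
* §3 COLUMN FIELD-LOCALITY of 59b ∕ 63 ∕ 64's operator: `mul_Sf_apply` ∕ `mul_SBf_apply`, `one_add_fibDiag_apply`, **`covLap_apply_congr`**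
  (column `(y,b)` of `Δ_W` reads `W⁺_μ(y − e_μ)`, `W⁻_μ(y + e_μ)` only), `PU_apply_congr`, **`covOp_apply_congr`**, `covOp_mul_wOp_eq_of_agree`.
* §4 the GAUGED junction: `conj_mul_wOp`, **`gauged_colAgree`** (exact covariance + column agreement in the gauge ⟹ `A·H = (fibD g⁻¹A′fibD g)·H`),
  `gauged_local_inverse`, and the END **`resummation_gauged`** ∕ **`covOp_resummation`** = (3.87)–(3.88)'s first line for
  `Δ_W + m² + a_KP_K(U)` with `A_□ = fibD ĝ_□⁻¹·covOp(local data)·fibD ĝ_□`, `G_□ = fibD ĝ_□⁻¹·covOp(local data)⁻¹·fibD ĝ_□`.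
WHAT IT IS NOT.  The commutator `H_□A_□ − A_□H_□` in (3.88)'s first-order shape and its K-free letters, the truncation windows of the local
fields, and the block walk expansion of `(1 − R)⁻¹` (56 §3) are separate files; OBJECT level untouched.

References (method only): T. Bałaban, Comm. Math. Phys. **99** (1985) 389–434 [B9], (3.8) p. 392, (3.35) p. 396, (3.50) p. 400, (3.87)–(3.88) p. 409, p. 410.
-/

noncomputable section

namespace Summit.QuantumFields.BalabanUV.Gaps.D4WalkBlockSeedResummation

open Finset Complex Matrix
open scoped BigOperators Matrix
open Literature.MathematicalPhysics.QuantumFieldTheory.Balaban1983to89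
open Literature.MathematicalPhysics.QuantumFieldTheory.Balaban1983to89.B5Ineq137Torus (blk)
open Summit.QuantumFields.BalabanUV.Gaps.D4WalkBlockShiftAlgebra (fibD relab relab_mul_apply)
open Summit.QuantumFields.BalabanUV.Gaps.D4WalkBlockShiftWeighted (wOp wOp_mul_apply wOp_mul_fibD fibD_mul_wOp)
open Summit.QuantumFields.BalabanUV.Gaps.D4WalkBlockShiftWeightedAv (wOp_eq_diagonal mul_wOp_apply)
open Summit.QuantumFields.BalabanUV.Gaps.D4WalkBlockGaugeAlgebra (fibD_const_one fibD_mul_fibD_eq_one)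
open Summit.QuantumFields.BalabanUV.Gaps.D4WalkBlockCovariantDerivative (wOp_mul_wOp wOp_mul_fibD_comm)
open Summit.QuantumFields.BalabanUV.Gaps.D4WalkBlockCovariantGeometry (fibDiag SBf SBf_mul_apply shift_unshift)
open Summit.QuantumFields.BalabanUV.Gaps.D4WalkBlockCovariantShift (Sf covLap)
open Summit.QuantumFields.BalabanUV.Gaps.D4WalkBlockCovariantPropagator (covOp Sf_transpose unshift_shift)
open Summit.QuantumFields.BalabanUV.Gaps.D4WalkBlockCovariantBlockAveraging (PU wK)
open Summit.QuantumFields.BalabanUV.Gaps.D4WalkBlockFormGaugeTorus (Sf_eq_relab covOp_gauge)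

/-! ## §1. The resummation from column agreement -/

section Resummation
variable {n B : Type*} [Fintype n] [DecidableEq n] [Fintype B]

/-- **(3.87)–(3.88) WITH WHOLE-SPACE LOCAL OPERATORS.**  If `Σ_b H_b² = 1`, the columns of `A` behind each `H_b` are those of `A_b`
(`A·H_b = A_b·H_b`) and `A_b·G_b = 1`, then `A·Σ_b H_bG_bH_b = 1 − Σ_b (H_bA_b − A_bH_b)G_bH_b`.  No compression, no projection:
`H_b`, `A_b`, `G_b` are arbitrary square matrices. [cite: Balaban1985BackgroundPropagators, (3.87)–(3.88) p.409] -/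
theorem resummation_of_colAgree (A : Matrix n n ℂ) (Ab Gb H : B → Matrix n n ℂ) (hsum : ∑ b, H b * H b = 1)
    (hcol : ∀ b, A * H b = Ab b * H b) (hinv : ∀ b, Ab b * Gb b = 1) :
    A * ∑ b, H b * Gb b * H b = 1 - ∑ b, (H b * Ab b - Ab b * H b) * Gb b * H b := by
  have hterm : ∀ b, A * (H b * Gb b * H b) = H b * H b - (H b * Ab b - Ab b * H b) * Gb b * H b := by
    intro b
    have h1 : H b * Ab b * Gb b * H b = H b * H b := by
      rw [Matrix.mul_assoc (H b) (Ab b) (Gb b), hinv b, Matrix.mul_one]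
    rw [← Matrix.mul_assoc, ← Matrix.mul_assoc, hcol b, Matrix.sub_mul, Matrix.sub_mul, h1, sub_sub_cancel]
  rw [Finset.mul_sum, Finset.sum_congr rfl fun b _ => hterm b, Finset.sum_sub_distrib, hsum]

/-- `A·S = 1 − R` with `1 − R` invertible ⟹ `S(1 − R)⁻¹` is a right inverse of `A`. ([folklore]) -/
theorem rightInverse_of_resummation (A S R : Matrix n n ℂ) (h : A * S = 1 - R) (hR : IsUnit (1 - R).det) :
    A * (S * (1 - R)⁻¹) = 1 := by
  rw [← Matrix.mul_assoc, h, Matrix.mul_nonsing_inv _ hR]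

/-- `A·S = 1 − R` with `1 − R` invertible ⟹ `A⁻¹ = S(1 − R)⁻¹` (print: `G = Σ_□ h_□G_□h_□·(1 − R)⁻¹`).
[cite: Balaban1985BackgroundPropagators, (3.88)–(3.90) p.409] -/
theorem inv_eq_of_resummation (A S R : Matrix n n ℂ) (h : A * S = 1 - R) (hR : IsUnit (1 - R).det) :
    A⁻¹ = S * (1 - R)⁻¹ :=
  Matrix.inv_eq_right_inv (rightInverse_of_resummation A S R h hR)

end Resummation

/-! ## §2. The weight-operator algebra of the junction -/

section WeightLin
variable {X F : Type} [DecidableEq X] [DecidableEq F]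

/-- `wOp` is additive. ([folklore]) -/
theorem wOp_add (w w' : X → ℝ) : wOp X F (fun x => w x + w' x) = wOp X F w + wOp X F w' := by
  rw [wOp_eq_diagonal, wOp_eq_diagonal, wOp_eq_diagonal, Matrix.diagonal_add]
  congr 1; funext q; push_cast; rfl

/-- `wOp` of a negative. ([folklore]) -/
theorem wOp_neg (w : X → ℝ) : wOp X F (fun x => -w x) = -wOp X F w := by
  rw [wOp_eq_diagonal, wOp_eq_diagonal, Matrix.diagonal_neg]
  congr 1; funext q; push_cast; rfl

/-- `wOp` is subtractive. ([folklore]) -/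
theorem wOp_sub (w w' : X → ℝ) : wOp X F (fun x => w x - w' x) = wOp X F w - wOp X F w' := by
  simp only [sub_eq_add_neg]
  rw [← wOp_neg, ← wOp_add]

/-- `wOp` of a real multiple. ([folklore]) -/
theorem wOp_smul (c : ℝ) (w : X → ℝ) : wOp X F (fun x => c * w x) = (c : ℂ) • wOp X F w := by
  rw [wOp_eq_diagonal, wOp_eq_diagonal, ← Matrix.diagonal_smul]
  congr 1; funext q; simp only [Pi.smul_apply, smul_eq_mul]; push_cast; rfl

/-- `wOp` of the zero weight. ([folklore]) -/
theorem wOp_zero : wOp X F (fun _ => (0 : ℝ)) = 0 := by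
  rw [wOp_eq_diagonal]; simp

/-- `wOp` of a finite sum of weights. ([folklore]) -/
theorem wOp_sum {κ : Type*} (s : Finset κ) (w : κ → X → ℝ) :
    wOp X F (fun x => ∑ i ∈ s, w i x) = ∑ i ∈ s, wOp X F (w i) := by
  classical
  induction s using Finset.induction_on with
  | empty => simp only [Finset.sum_empty]; exact wOp_zero
  | insert a s ha ih =>
    rw [Finset.sum_insert ha, ← ih, ← wOp_add]
    congr 1; funext x; rw [Finset.sum_insert ha]

/-- `wOp 1 = 1`. ([folklore]) -/
theorem wOp_const_one : wOp X F (fun _ => (1 : ℝ)) = 1 := by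
  unfold wOp; simp only [Complex.ofReal_one, one_smul]; exact fibD_const_one

end WeightLin

section Weight
variable {X F : Type} [Fintype X] [Fintype F] [DecidableEq X] [DecidableEq F]

/-- **A partition of unity `Σ_b h_b² = 1` gives `Σ_b (h_b ⊗ 1)(h_b ⊗ 1) = 1`** (print's `Σ_□ h_□² = 1`).
[cite: Balaban1985BackgroundPropagators, (3.87) p.409] -/
theorem sum_wOp_sq {B : Type*} [Fintype B] (h : B → X → ℝ) (hsum : ∀ x, ∑ b, h b x ^ 2 = 1) :
    ∑ b, wOp X F (h b) * wOp X F (h b) = 1 := by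
  simp only [wOp_mul_wOp]
  rw [← wOp_sum, ← wOp_const_one (X := X) (F := F)]
  congr 1; funext x; rw [← hsum x]; exact Finset.sum_congr rfl fun b _ => by ring

/-- **`[h ⊗ 1, M]_{pq} = (h(p) − h(q))·M_{pq}`** — the commutator with a site multiplier is the entrywise product with the oscillation
of `h` (for a kernel living in the diagonal unit blocks, like `P_K(U)`, it is `O(osc_block h)`; for `m²·1` it vanishes).
[cite: Balaban1985BackgroundPropagators, (3.88) p.409] -/
theorem wOp_commutator_apply (h : X → ℝ) (M : Matrix (X × F) (X × F) ℂ) (p q : X × F) :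
    (wOp X F h * M - M * wOp X F h) p q = ((h p.1 - h q.1 : ℝ) : ℂ) * M p q := by
  rw [Matrix.sub_apply, wOp_mul_apply, mul_wOp_apply, Complex.ofReal_sub]; ring

/-- the commutator with a site-diagonal fibre operator vanishes. ([folklore]) -/
theorem wOp_commutator_fibD (h : X → ℝ) (a : X → Matrix F F ℂ) : wOp X F h * fibD X F a - fibD X F a * wOp X F h = 0 := by
  rw [wOp_mul_fibD_comm, sub_self]

/-- the commutator with a scalar vanishes. ([folklore]) -/
theorem wOp_commutator_smul_one (h : X → ℝ) (c : ℂ) :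
    wOp X F h * (c • (1 : Matrix (X × F) (X × F) ℂ)) - c • (1 : Matrix (X × F) (X × F) ℂ) * wOp X F h = 0 := by
  rw [Matrix.mul_smul, Matrix.smul_mul, Matrix.mul_one, Matrix.one_mul, sub_self]

/-- **COLUMN AGREEMENT ⟹ `M·(h ⊗ 1) = M′·(h ⊗ 1)`** for `h` vanishing off `S`: the hypothesis `A·H_b = A_b·H_b` of §1 from equal columns
over `S ⊇ supp h`. ([folklore]) -/
theorem mul_wOp_eq_of_columns (M M' : Matrix (X × F) (X × F) ℂ) (S : Set X) (h : X → ℝ) (hh : ∀ y, y ∉ S → h y = 0)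
    (hcolS : ∀ p q : X × F, q.1 ∈ S → M p q = M' p q) : M * wOp X F h = M' * wOp X F h := by
  ext p q
  rw [mul_wOp_apply, mul_wOp_apply]
  by_cases hq : q.1 ∈ S
  · rw [hcolS p q hq]
  · rw [hh q.1 hq, Complex.ofReal_zero, mul_zero, mul_zero]

/-- ROW AGREEMENT ⟹ `(h ⊗ 1)·M = (h ⊗ 1)·M′` (the transposed twin). ([folklore]) -/
theorem wOp_mul_eq_of_rows (M M' : Matrix (X × F) (X × F) ℂ) (S : Set X) (h : X → ℝ) (hh : ∀ y, y ∉ S → h y = 0)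
    (hrowS : ∀ p q : X × F, p.1 ∈ S → M p q = M' p q) : wOp X F h * M = wOp X F h * M' := by
  ext p q
  rw [wOp_mul_apply, wOp_mul_apply]
  by_cases hp : p.1 ∈ S
  · rw [hrowS p q hp]
  · rw [hh p.1 hp, Complex.ofReal_zero, zero_mul, zero_mul]

end Weight

/-! ## §3. Column field-locality of the one-scale covariant operator -/

section FieldLocality
variable (P : Params) (F : Type) [Fintype F] [DecidableEq F]
variable {E : Type*}

/-- columns of `M·(S_μ ⊗ 1)` are the columns of `M` one fine step BACK: `(M·S_μ)_{p,(y,b)} = M_{p,(y − e_μ,b)}`. ([folklore]) -/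
theorem mul_Sf_apply (μ : Fin P.d) (M : Matrix (Site P 0 × F) (Site P 0 × F) ℂ) (p q : Site P 0 × F) :
    (M * Sf P F μ) p q = M p (Site.unshift q.1 μ, q.2) := by
  rw [← Matrix.transpose_apply (M * Sf P F μ) q p, Matrix.transpose_mul, Sf_transpose, SBf_mul_apply, Matrix.transpose_apply]

/-- columns of `M·(S⁻_μ ⊗ 1)` are the columns of `M` one fine step FORWARD: `(M·S⁻_μ)_{p,(y,b)} = M_{p,(y + e_μ,b)}`. ([folklore]) -/
theorem mul_SBf_apply (μ : Fin P.d) (M : Matrix (Site P 0 × F) (Site P 0 × F) ℂ) (p q : Site P 0 × F) :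
    (M * SBf P F μ) p q = M p (Site.shift q.1 μ, q.2) := by
  rw [← Matrix.transpose_apply (M * SBf P F μ) q p, Matrix.transpose_mul, ← Sf_transpose, Matrix.transpose_transpose,
    Sf_eq_relab, relab_mul_apply, Matrix.transpose_apply]

omit [Fintype F] in
/-- entries of `1 + fibDiag W`: `[x = x′]·(1 + W(x))_{ab}`. ([folklore]) -/
theorem one_add_fibDiag_apply (W : Site P 0 → Matrix F F ℂ) (p r : Site P 0 × F) :
    (1 + fibDiag P F W) p r = if p.1 = r.1 then (1 + W p.1) p.2 r.2 else 0 := by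
  rw [Matrix.add_apply, Matrix.one_apply]
  unfold fibDiag
  rw [Matrix.of_apply]
  by_cases h : p.1 = r.1
  · rw [if_pos h, if_pos h, Matrix.add_apply, Matrix.one_apply]
    by_cases h2 : p.2 = r.2
    · rw [if_pos h2, if_pos (Prod.ext h h2)]
    · rw [if_neg h2, if_neg (fun e => h2 (congrArg Prod.snd e))]
  · rw [if_neg h, if_neg h, if_neg (fun e => h (congrArg Prod.fst e)), zero_add]

variable (Wp Wm Wp' Wm' : Fin P.d → E → Site P 0 → Matrix F F ℂ)

/-- **THE COLUMN `(y, b)` OF `Δ_W(u)` READS `W⁺_μ(u, y − e_μ)` AND `W⁻_μ(u, y + e_μ)` ONLY** (59b (3.50): `(1 + W⁺_μ(x))λ(x + e_μ)`,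
`(1 + W⁻_μ(x))λ(x − e_μ)`): two defect families agreeing there give the same column. [cite: Balaban1985BackgroundPropagators, (3.50) p.400] -/
theorem covLap_apply_congr (u : E) (p q : Site P 0 × F)
    (hp : ∀ μ, Wp μ u (Site.unshift q.1 μ) = Wp' μ u (Site.unshift q.1 μ))
    (hm : ∀ μ, Wm μ u (Site.shift q.1 μ) = Wm' μ u (Site.shift q.1 μ)) :
    covLap P F Wp Wm u p q = covLap P F Wp' Wm' u p q := by
  have e1 : ∀ μ, ((1 + fibDiag P F (Wp μ u)) * Sf P F μ) p q = ((1 + fibDiag P F (Wp' μ u)) * Sf P F μ) p q := by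
    intro μ
    rw [mul_Sf_apply, mul_Sf_apply, one_add_fibDiag_apply, one_add_fibDiag_apply]
    split_ifs with h
    · rw [h, hp μ]
    · rfl
  have e2 : ∀ μ, ((1 + fibDiag P F (Wm μ u)) * SBf P F μ) p q = ((1 + fibDiag P F (Wm' μ u)) * SBf P F μ) p q := by
    intro μ
    rw [mul_SBf_apply, mul_SBf_apply, one_add_fibDiag_apply, one_add_fibDiag_apply]
    split_ifs with h
    · rw [h, hm μ]
    · rfl
  unfold covLap
  rw [Matrix.smul_apply, Matrix.smul_apply, Matrix.sum_apply, Matrix.sum_apply]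
  congr 1
  refine Finset.sum_congr rfl fun μ _ => ?_
  rw [Matrix.sub_apply, Matrix.sub_apply, Matrix.sub_apply, Matrix.sub_apply, e1 μ, e2 μ]

variable (Ug Ugi Ug' Ugi' : E → Site P 0 → Matrix F F ℂ)

omit [DecidableEq F] in
/-- entries of 64's covariant block-averaging projector (its definition). [cite: Balaban1985BackgroundPropagators, (3.8) p.392] -/
theorem PU_apply (u : E) (p q : Site P 0 × F) :
    PU P F Ug Ugi u p q = if blk P P.K p.1 = blk P P.K q.1 then (wK P : ℂ) * (Ugi u p.1 * Ug u q.1) p.2 q.2 else 0 := rfl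

omit [DecidableEq F] in
/-- **THE COLUMN `(y, b)` OF `P_K(U)(u)` READS `U(Γ_{·,y})` AND THE `U(Γ_{·,x})⁻¹` OF THE SITES `x` OF `y`'s UNIT BLOCK ONLY.**
[cite: Balaban1985BackgroundPropagators, (3.8) p.392] -/
theorem PU_apply_congr (u : E) (p q : Site P 0 × F) (hgi : blk P P.K p.1 = blk P P.K q.1 → Ugi u p.1 = Ugi' u p.1)
    (hg : Ug u q.1 = Ug' u q.1) : PU P F Ug Ugi u p q = PU P F Ug' Ugi' u p q := by
  rw [PU_apply, PU_apply]
  split_ifs with h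
  · rw [hgi h, hg]
  · rfl

variable (PU₁ PU₂ : E → Matrix (Site P 0 × F) (Site P 0 × F) ℂ) (a msq : ℝ)

/-- **COLUMN FIELD-LOCALITY OF `Δ_W + m² + a_KP_K(U)`**: the column `(y, b)` reads `W⁺_μ(y − e_μ)`, `W⁻_μ(y + e_μ)` and the column
`(y, b)` of the averaging kernel only. [cite: Balaban1985BackgroundPropagators, (3.8) p.392, (3.50) p.400, p.410] -/
theorem covOp_apply_congr (u : E) (p q : Site P 0 × F)
    (hp : ∀ μ, Wp μ u (Site.unshift q.1 μ) = Wp' μ u (Site.unshift q.1 μ))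
    (hm : ∀ μ, Wm μ u (Site.shift q.1 μ) = Wm' μ u (Site.shift q.1 μ)) (hP : PU₁ u p q = PU₂ u p q) :
    covOp P F Wp Wm PU₁ a msq u p q = covOp P F Wp' Wm' PU₂ a msq u p q := by
  unfold covOp
  simp only [Matrix.add_apply, Matrix.smul_apply, hP, covLap_apply_congr P F Wp Wm Wp' Wm' u p q hp hm]

/-- **FIELD AGREEMENT ON THE BONDS READ OVER `S` ⟹ `covOp·(h ⊗ 1) = covOp′·(h ⊗ 1)`** for `supp h ⊆ S` (print: the term «depends on U
restricted to □̃»). [cite: Balaban1985BackgroundPropagators, (3.87) p.409, p.410] -/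
theorem covOp_mul_wOp_eq_of_agree (S : Set (Site P 0)) (h : Site P 0 → ℝ) (hh : ∀ y, y ∉ S → h y = 0) (u : E)
    (hp : ∀ μ y, y ∈ S → Wp μ u (Site.unshift y μ) = Wp' μ u (Site.unshift y μ))
    (hm : ∀ μ y, y ∈ S → Wm μ u (Site.shift y μ) = Wm' μ u (Site.shift y μ))
    (hP : ∀ p q : Site P 0 × F, q.1 ∈ S → PU₁ u p q = PU₂ u p q) :
    covOp P F Wp Wm PU₁ a msq u * wOp (Site P 0) F h = covOp P F Wp' Wm' PU₂ a msq u * wOp (Site P 0) F h :=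
  mul_wOp_eq_of_columns _ _ S h hh fun p q hq =>
    covOp_apply_congr P F Wp Wm Wp' Wm' PU₁ PU₂ a msq u p q (fun μ => hp μ q.1 hq) (fun μ => hm μ q.1 hq) (hP p q hq)

/-- The same for 64's genuine projectors from agreement of the block-contour transporters on the unit blocks of `S`.
[cite: Balaban1985BackgroundPropagators, (3.8) p.392, (3.87) p.409] -/
theorem covOp_PU_mul_wOp_eq_of_agree (S : Set (Site P 0)) (h : Site P 0 → ℝ) (hh : ∀ y, y ∉ S → h y = 0) (u : E)
    (hp : ∀ μ y, y ∈ S → Wp μ u (Site.unshift y μ) = Wp' μ u (Site.unshift y μ))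
    (hm : ∀ μ y, y ∈ S → Wm μ u (Site.shift y μ) = Wm' μ u (Site.shift y μ))
    (hgi : ∀ x y, y ∈ S → blk P P.K x = blk P P.K y → Ugi u x = Ugi' u x) (hg : ∀ y, y ∈ S → Ug u y = Ug' u y) :
    covOp P F Wp Wm (PU P F Ug Ugi) a msq u * wOp (Site P 0) F h =
      covOp P F Wp' Wm' (PU P F Ug' Ugi') a msq u * wOp (Site P 0) F h :=
  covOp_mul_wOp_eq_of_agree P F Wp Wm Wp' Wm' _ _ a msq S h hh u hp hm fun p q hq =>
    PU_apply_congr P F Ug Ugi Ug' Ugi' u p q (fun hb => hgi p.1 q.1 hq hb) (hg q.1 hq)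

end FieldLocality

/-! ## §4. The gauged junction and the END -/

section Gauged
variable {X F : Type} [Fintype X] [Fintype F] [DecidableEq X] [DecidableEq F]

/-- the weight passes through a gauge conjugation: `(fibD g⁻¹·M·fibD g)·(h ⊗ 1) = fibD g⁻¹·(M·(h ⊗ 1))·fibD g`. ([folklore]) -/
theorem conj_mul_wOp (g gi : X → Matrix F F ℂ) (M : Matrix (X × F) (X × F) ℂ) (h : X → ℝ) :
    fibD X F gi * M * fibD X F g * wOp X F h = fibD X F gi * (M * wOp X F h) * fibD X F g := by
  rw [Matrix.mul_assoc (fibD X F gi * M), ← wOp_mul_fibD_comm, ← Matrix.mul_assoc, Matrix.mul_assoc (fibD X F gi)]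

/-- the weight passes through a gauge conjugation (left form). ([folklore]) -/
theorem wOp_mul_conj (g gi : X → Matrix F F ℂ) (M : Matrix (X × F) (X × F) ℂ) (h : X → ℝ) :
    wOp X F h * (fibD X F gi * M * fibD X F g) = fibD X F gi * (wOp X F h * M) * fibD X F g := by
  rw [← Matrix.mul_assoc, ← Matrix.mul_assoc, wOp_mul_fibD_comm, Matrix.mul_assoc (fibD X F gi)]

/-- **THE GAUGED COLUMN AGREEMENT** (hypothesis `A·H_b = A_b·H_b` of §1 in ROAD (c′)): if `fibD g·A·fibD g⁻¹ = Aᵍ` (exact covariance,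
`gg⁻¹ = 1 = g⁻¹g` sitewise) and the columns of `Aᵍ` over `S ⊇ supp h` are those of a (local) operator `A′`, then
`A·(h ⊗ 1) = (fibD g⁻¹·A′·fibD g)·(h ⊗ 1)`. [cite: Balaban1985BackgroundPropagators, (3.35) p.396, (3.87) p.409, p.410] -/
theorem gauged_colAgree (g gi : X → Matrix F F ℂ) (hgi : ∀ x, gi x * g x = 1) (A Ag A' : Matrix (X × F) (X × F) ℂ)
    (hcov : fibD X F g * A * fibD X F gi = Ag) (S : Set X) (h : X → ℝ) (hh : ∀ y, y ∉ S → h y = 0)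
    (hcolS : ∀ p q : X × F, q.1 ∈ S → Ag p q = A' p q) :
    A * wOp X F h = fibD X F gi * A' * fibD X F g * wOp X F h := by
  have hA : A = fibD X F gi * Ag * fibD X F g := by
    rw [← hcov, ← Matrix.mul_assoc, ← Matrix.mul_assoc, fibD_mul_fibD_eq_one hgi, Matrix.one_mul, Matrix.mul_assoc,
      fibD_mul_fibD_eq_one hgi, Matrix.mul_one]
  rw [hA, conj_mul_wOp, conj_mul_wOp, mul_wOp_eq_of_columns Ag A' S h hh hcolS]

/-- **THE GAUGED LOCAL INVERSE**: `(fibD g⁻¹·A′·fibD g)·(fibD g⁻¹·A′⁻¹·fibD g) = 1` for `A′` invertible and `gg⁻¹ = 1 = g⁻¹g`. ([folklore]) -/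
theorem gauged_local_inverse (g gi : X → Matrix F F ℂ) (hg : ∀ x, g x * gi x = 1) (hgi : ∀ x, gi x * g x = 1)
    (A' : Matrix (X × F) (X × F) ℂ) (hA' : IsUnit A'.det) :
    fibD X F gi * A' * fibD X F g * (fibD X F gi * A'⁻¹ * fibD X F g) = 1 := by
  have h1 : fibD X F g * (fibD X F gi * A'⁻¹ * fibD X F g) = A'⁻¹ * fibD X F g := by
    rw [← Matrix.mul_assoc, ← Matrix.mul_assoc, fibD_mul_fibD_eq_one hg, Matrix.one_mul]
  rw [Matrix.mul_assoc, h1, Matrix.mul_assoc (fibD X F gi) A', ← Matrix.mul_assoc A', Matrix.mul_nonsing_inv _ hA',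
    Matrix.one_mul, fibD_mul_fibD_eq_one hgi]

variable {B : Type*} [Fintype B]

/-- **(3.87)–(3.88) FROM WHOLE-SPACE LOCAL OPERATORS IN PER-CUBE GAUGES.**  Data: a partition of unity `Σ_b h_b² = 1` with
`supp h_b ⊆ S_b`; sitewise-invertible site gauges `(g_b, g_b⁻¹)`; an operator `A` and its gauge transforms `A^{g_b} = fibD g_b·A·fibD g_b⁻¹`;
per-cube LOCAL operators `A′_b`, invertible, whose columns over `S_b` are those of `A^{g_b}`.  Then, with
`A_b := fibD g_b⁻¹·A′_b·fibD g_b`, `G_b := fibD g_b⁻¹·A′_b⁻¹·fibD g_b`, `H_b := h_b ⊗ 1`: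
`A·Σ_b H_bG_bH_b = 1 − Σ_b (H_bA_b − A_bH_b)G_bH_b`. [cite: Balaban1985BackgroundPropagators, (3.35) p.396, (3.87)–(3.88) p.409, p.410] -/
theorem resummation_gauged (A : Matrix (X × F) (X × F) ℂ) (g gi : B → X → Matrix F F ℂ) (hg : ∀ b x, g b x * gi b x = 1)
    (hgi : ∀ b x, gi b x * g b x = 1) (Ag A' : B → Matrix (X × F) (X × F) ℂ) (hcov : ∀ b, fibD X F (g b) * A * fibD X F (gi b) = Ag b)
    (hA' : ∀ b, IsUnit (A' b).det) (S : B → Set X) (h : B → X → ℝ) (hh : ∀ b y, y ∉ S b → h b y = 0)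
    (hsum : ∀ x, ∑ b, h b x ^ 2 = 1) (hcolS : ∀ b (p q : X × F), q.1 ∈ S b → Ag b p q = A' b p q) :
    A * ∑ b, wOp X F (h b) * (fibD X F (gi b) * (A' b)⁻¹ * fibD X F (g b)) * wOp X F (h b)
      = 1 - ∑ b, (wOp X F (h b) * (fibD X F (gi b) * A' b * fibD X F (g b)) - (fibD X F (gi b) * A' b * fibD X F (g b)) * wOp X F (h b))
          * (fibD X F (gi b) * (A' b)⁻¹ * fibD X F (g b)) * wOp X F (h b) :=
  resummation_of_colAgree A (fun b => fibD X F (gi b) * A' b * fibD X F (g b))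
    (fun b => fibD X F (gi b) * (A' b)⁻¹ * fibD X F (g b)) (fun b => wOp X F (h b)) (sum_wOp_sq h hsum)
    (fun b => gauged_colAgree (g b) (gi b) (hgi b) A (Ag b) (A' b) (hcov b) (S b) (h b) (hh b) (hcolS b))
    (fun b => gauged_local_inverse (g b) (gi b) (hg b) (hgi b) (A' b) (hA' b))

end Gauged

section End
variable (P : Params) (F : Type) [Fintype F] [DecidableEq F]
variable {E : Type*} {B : Type*} [Fintype B]
variable (Wp Wm : Fin P.d → E → Site P 0 → Matrix F F ℂ) (Ug Ugi : E → Site P 0 → Matrix F F ℂ) (a msq : ℝ)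
variable (g gi : B → Site P 0 → Matrix F F ℂ) (Wpl Wml : B → Fin P.d → E → Site P 0 → Matrix F F ℂ)
  (Ugl Ugil : B → E → Site P 0 → Matrix F F ℂ) (S : B → Set (Site P 0)) (h : B → Site P 0 → ℝ)

/-- **(3.87)–(3.88), FIRST LINE, FOR `Δ_W + m² + a_KP_K(U)` WITH WHOLE-TORUS LOCAL FIELDS IN PER-CUBE GAUGES** (ROAD (c′) of
g1-plan-1 GEN 39).  Data at a configuration `u`: the defects `W^±` and block-contour transporters `U(Γ)` of the field; a partition of
unity `Σ_b h_b² = 1`, `supp h_b ⊆ S_b`; per-cube site gauges `(g_b, g_b⁻¹)`; per-cube LOCAL field data `(W̃^±_b, Ũ_b(Γ))` on the whole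
torus which AGREE WITH THE GAUGED DATA OF THE FIELD on what the columns over `S_b` read — `W̃⁺_{b,μ}(y − e_μ) = (W⁺_μ)^{g_b}(y − e_μ)`,
`W̃⁻_{b,μ}(y + e_μ) = (W⁻_μ)^{g_b}(y + e_μ)` (`y ∈ S_b`), the gauged transporters on the unit blocks of `S_b` — and whose one-scale
covariant operators `A′_b := covOp(W̃_b, P_K(Ũ_b))` are invertible.  Then
`covOp(W, P_K(U))(u)·Σ_b H_bG_bH_b = 1 − Σ_b (H_bA_b − A_bH_b)G_bH_b`, `A_b = fibD g_b⁻¹A′_bfibD g_b`, `G_b = fibD g_b⁻¹A′_b⁻¹fibD g_b`.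
The gauged data are those of 118's `covOp_gauge`. [cite: Balaban1985BackgroundPropagators, (3.8) p.392, (3.35) p.396, (3.50) p.400, (3.87)–(3.88) p.409, p.410] -/
theorem covOp_resummation (hg : ∀ b x, g b x * gi b x = 1) (hgi : ∀ b x, gi b x * g b x = 1)
    (hh : ∀ b y, y ∉ S b → h b y = 0) (hsum : ∀ x, ∑ b, h b x ^ 2 = 1) (u : E)
    (hp : ∀ b μ y, y ∈ S b → Wpl b μ u (Site.unshift y μ) =
      g b (Site.unshift y μ) * (1 + Wp μ u (Site.unshift y μ)) * gi b (Site.shift (Site.unshift y μ) μ) - 1)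
    (hm : ∀ b μ y, y ∈ S b → Wml b μ u (Site.shift y μ) =
      g b (Site.shift y μ) * (1 + Wm μ u (Site.shift y μ)) * gi b (Site.unshift (Site.shift y μ) μ) - 1)
    (hUgi : ∀ b x y, y ∈ S b → blk P P.K x = blk P P.K y → Ugil b u x = g b x * Ugi u x)
    (hUg : ∀ b y, y ∈ S b → Ugl b u y = Ug u y * gi b y)
    (hA' : ∀ b, IsUnit (covOp P F (Wpl b) (Wml b) (PU P F (Ugl b) (Ugil b)) a msq u).det) :
    covOp P F Wp Wm (PU P F Ug Ugi) a msq u *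
        ∑ b, wOp (Site P 0) F (h b) *
          (fibD (Site P 0) F (gi b) * (covOp P F (Wpl b) (Wml b) (PU P F (Ugl b) (Ugil b)) a msq u)⁻¹ * fibD (Site P 0) F (g b)) *
          wOp (Site P 0) F (h b)
      = 1 - ∑ b, (wOp (Site P 0) F (h b) *
            (fibD (Site P 0) F (gi b) * covOp P F (Wpl b) (Wml b) (PU P F (Ugl b) (Ugil b)) a msq u * fibD (Site P 0) F (g b)) -
          (fibD (Site P 0) F (gi b) * covOp P F (Wpl b) (Wml b) (PU P F (Ugl b) (Ugil b)) a msq u * fibD (Site P 0) F (g b)) *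
            wOp (Site P 0) F (h b)) *
          (fibD (Site P 0) F (gi b) * (covOp P F (Wpl b) (Wml b) (PU P F (Ugl b) (Ugil b)) a msq u)⁻¹ * fibD (Site P 0) F (g b)) *
          wOp (Site P 0) F (h b) := by
  refine resummation_gauged _ g gi hg hgi
    (fun b => covOp P F (fun μ u x => g b x * (1 + Wp μ u x) * gi b (Site.shift x μ) - 1)
      (fun μ u x => g b x * (1 + Wm μ u x) * gi b (Site.unshift x μ) - 1)
      (PU P F (fun u x => Ug u x * gi b x) (fun u x => g b x * Ugi u x)) a msq u)
    (fun b => covOp P F (Wpl b) (Wml b) (PU P F (Ugl b) (Ugil b)) a msq u) (fun b => covOp_gauge (g b) (gi b) Wp Wm Ug Ugi a msq (hg b) u)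
    hA' S h hh hsum fun b p q hq => ?_
  refine covOp_apply_congr P F _ _ _ _ _ _ a msq u p q (fun μ => (hp b μ q.1 hq).symm) (fun μ => (hm b μ q.1 hq).symm) ?_
  exact PU_apply_congr P F _ _ _ _ u p q (fun hb => (hUgi b p.1 q.1 hq hb).symm) (hUg b q.1 hq).symm

end End

end Summit.QuantumFields.BalabanUV.Gaps.D4WalkBlockSeedResummation

end
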